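import Mathlib
import Summits.Ventures.HodgeRepro.Tier4.Target
import Summits.Ventures.HodgeRepro.Tier4.Common.AutForms
import Summits.Ventures.HodgeRepro.Tier4.Line3.DatumOrthVanishing
import Summits.Ventures.HodgeRepro.Tier4.Line3.HeckeEquivarianceLemmas
import Summits.Ventures.HodgeRepro.Tier4.Line3.KernelIntegralPos
import Summits.Ventures.HodgeRepro.Tier4.Line3.SlotFunctionAlgebra
import Summits.Ventures.HodgeRepro.Tier4.Line3.ModelIntegrand
import Summits.Ventures.HodgeRepro.Tier4.Line3.ShapeIntegrandBounds

/-!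
# Tier4/Line3/ShapeIntegralBounds — the shape integral over the ball: integrable, `c s⁻⁴ ≤ Φ(s) ≤ A₁ s⁻⁴ + A₂ s⁻⁶`

Blind re-derivation cell `pub-hodge-repro`, Tier 4 «PROVE THE STEP» (README §9–§10), LINE L3, seat t4-L3-p1 (gen 3),
self-cut C-L3-DILCOMP (bus S14565), module 4 of 5.  Throughout, `y₀, y₁` have independent first coordinates (`hab`)
and span a `J`-positive plane (`hpos`), `W` is continuous on the ball with `‖W‖ ≤ C₁ + C₂/g` (`C₁, C₂ ≥ 0`) and
`W(z*) ≠ 0` at the common zero `z* = commonZero y₀ y₁`.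

* `exists_good_radius`: a sup-norm ball `B(z*, r) ⊆ 𝔹` on which `g ≥ g(z*)/2` and `‖W‖² ≥ ‖W(z*)‖²/2` (continuity);
* `integrableOn_shapeInt`: `shapeInt α β` is integrable on `𝔹` for all `α, β > 0` (continuous on the ball, bounded by the
  crude near bound on `B(z*, r)` and by the far bound at `m = min α β` off it; `𝔹` has finite measure);
* `exists_lower_bound`: `c s⁻⁴ ≤ Φ(s) := ∫_𝔹 shapeInt (2s) (2s)` for `s ≥ 1`, `c > 0` — restrict to `B(z*, r)`,
  bound below by the model integrand, translate to `0`, dilate by `√s`, shrink `B(0, √s r)` back to `B(0, r)`;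
* `exists_upper_bound`: `Φ(s) ≤ A₁ s⁻⁴ + A₂ s⁻⁶` for all `s > 0` — the near part through the model integral over `ℂ²`
  (dilation), the far part through the pointwise far bound times the volume of the ball.

Imports: Mathlib, `Tier4/Target`, `Line3/{DatumOrthVanishing, HeckeEquivarianceLemmas, KernelIntegralPos,
SlotFunctionAlgebra, ModelIntegrand, ShapeIntegrandBounds}` by name.  `#print axioms` of every theorem =
`[propext, Classical.choice, Quot.sound]`.  No printed input is consumed.  Nothing here asserts anything about the truth of (P); HC_CM is NOT proved by anyone in this repository.
-/

set_option autoImplicit false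

noncomputable section

namespace Summit.Ventures.HodgeRepro.Tier4.Line3

open Summit.Ventures.HodgeRepro.Tier4
open Matrix MeasureTheory
open scoped ComplexConjugate

/-! ## 7. The shape integral over the ball: integrable, bounded below by `c s⁻⁴`, above by `A₁ s⁻⁴ + A₂ s⁻⁶` -/

/-- **THE GOOD RADIUS:** a sup-norm ball around `z*` inside `𝔹` on which `g ≥ g(z*)/2` and `‖W‖² ≥ ‖W(z*)‖²/2`. -/
theorem exists_good_radius (y₀ y₁ : Fin 3 → ℂ) (hab : y₀ 0 * y₁ 1 - y₀ 1 * y₁ 0 ≠ 0)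
    (hpos : ∀ u v : ℂ, (u ≠ 0 ∨ v ≠ 0) →
      0 < (star (u • y₀ + v • y₁) ⬝ᵥ (J *ᵥ (u • y₀ + v • y₁))).re)
    (W : (Fin 2 → ℂ) → ℂ) (hWc : ContinuousOn W ball) (hW0 : W (commonZero y₀ y₁) ≠ 0) :
    ∃ r : ℝ, 0 < r ∧ Metric.ball (commonZero y₀ y₁) r ⊆ ball ∧
      (∀ z ∈ Metric.ball (commonZero y₀ y₁) r, (1 - nsq (commonZero y₀ y₁)) / 2 ≤ 1 - nsq z) ∧
      (∀ z ∈ Metric.ball (commonZero y₀ y₁) r, ‖W (commonZero y₀ y₁)‖ ^ 2 / 2 ≤ ‖W z‖ ^ 2) := by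
  have hzs : commonZero y₀ y₁ ∈ ball := commonZero_mem_ball y₀ y₁ hab hpos
  have hg0 : 0 < 1 - nsq (commonZero y₀ y₁) := by have : nsq (commonZero y₀ y₁) < 1 := hzs; linarith
  have h1 : ∀ᶠ z in nhds (commonZero y₀ y₁), z ∈ ball := isOpen_ball.mem_nhds hzs
  have hcont : ContinuousAt (fun z : Fin 2 → ℂ => 1 - nsq z) (commonZero y₀ y₁) :=
    (continuous_const.sub continuous_nsq).continuousAt
  have h2 : ∀ᶠ z in nhds (commonZero y₀ y₁), (1 - nsq (commonZero y₀ y₁)) / 2 < 1 - nsq z :=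
    Filter.Tendsto.eventually_const_lt
      (by show (1 - nsq (commonZero y₀ y₁)) / 2 < 1 - nsq (commonZero y₀ y₁); linarith) hcont
  have hWat : ContinuousAt W (commonZero y₀ y₁) := hWc.continuousAt (isOpen_ball.mem_nhds hzs)
  have hWpos : 0 < ‖W (commonZero y₀ y₁)‖ ^ 2 := by
    have := norm_pos_iff.2 hW0
    positivity
  have hWat2 : ContinuousAt (fun z => ‖W z‖ ^ 2) (commonZero y₀ y₁) := hWat.norm.pow 2
  have h3 : ∀ᶠ z in nhds (commonZero y₀ y₁), ‖W (commonZero y₀ y₁)‖ ^ 2 / 2 < ‖W z‖ ^ 2 :=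
    Filter.Tendsto.eventually_const_lt
      (by show ‖W (commonZero y₀ y₁)‖ ^ 2 / 2 < ‖W (commonZero y₀ y₁)‖ ^ 2; linarith) hWat2
  obtain ⟨r, hr, hball⟩ := Metric.eventually_nhds_iff.1 ((h1.and h2).and h3)
  exact ⟨r, hr, fun z hz => (hball (Metric.mem_ball.1 hz)).1.1, fun z hz => (hball (Metric.mem_ball.1 hz)).1.2.le,
    fun z hz => (hball (Metric.mem_ball.1 hz)).2.le⟩

/-- A crude pointwise bound on the ball where `g ≥ g₀`: `shapeInt α β z ≤ B₀² B₁² g₀^{-4} (C₁ + C₂/g₀)²` (`α, β ≥ 0`). -/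
theorem shapeInt_le_crude (y₀ y₁ : Fin 3 → ℂ) (W : (Fin 2 → ℂ) → ℂ) {g₀ C₁ C₂ α β : ℝ} (hg₀ : 0 < g₀)
    (hC₂ : 0 ≤ C₂) (hα : 0 ≤ α) (hβ : 0 ≤ β) {z : Fin 2 → ℂ} (hz : z ∈ ball) (hg : g₀ ≤ 1 - nsq z)
    (hW : ‖W z‖ ≤ C₁ + C₂ / (1 - nsq z)) :
    shapeInt y₀ y₁ W α β z ≤ (‖y₀ 0‖ + ‖y₀ 1‖ + ‖y₀ 2‖) ^ 2 * (‖y₁ 0‖ + ‖y₁ 1‖ + ‖y₁ 2‖) ^ 2 * (g₀ ^ 4)⁻¹ *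
      (C₁ + C₂ / g₀) ^ 2 := by
  unfold shapeInt
  have hgpos : 0 < 1 - nsq z := lt_of_lt_of_le hg₀ hg
  have hB0 : ‖star (lift3 z) ⬝ᵥ (J *ᵥ y₀)‖ ^ 2 ≤ (‖y₀ 0‖ + ‖y₀ 1‖ + ‖y₀ 2‖) ^ 2 :=
    pow_le_pow_left₀ (norm_nonneg _) (norm_jform_lift3_le y₀ hz) 2
  have hB1 : ‖star (lift3 z) ⬝ᵥ (J *ᵥ y₁)‖ ^ 2 ≤ (‖y₁ 0‖ + ‖y₁ 1‖ + ‖y₁ 2‖) ^ 2 :=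
    pow_le_pow_left₀ (norm_nonneg _) (norm_jform_lift3_le y₁ hz) 2
  have hW2 : ‖W z‖ ^ 2 ≤ (C₁ + C₂ / g₀) ^ 2 := by
    have : C₁ + C₂ / (1 - nsq z) ≤ C₁ + C₂ / g₀ := by gcongr
    exact pow_le_pow_left₀ (norm_nonneg _) (hW.trans this) 2
  have hexp : Real.exp (-(Real.pi * (α * (2 * ‖star (lift3 z) ⬝ᵥ (J *ᵥ y₀)‖ ^ 2 / (1 - nsq z)) +
      β * (2 * ‖star (lift3 z) ⬝ᵥ (J *ᵥ y₁)‖ ^ 2 / (1 - nsq z))))) ≤ 1 := by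
    rw [Real.exp_le_one_iff]
    have : 0 ≤ Real.pi * (α * (2 * ‖star (lift3 z) ⬝ᵥ (J *ᵥ y₀)‖ ^ 2 / (1 - nsq z)) +
      β * (2 * ‖star (lift3 z) ⬝ᵥ (J *ᵥ y₁)‖ ^ 2 / (1 - nsq z))) := by positivity
    linarith
  have hg4 : ((1 - nsq z) ^ 4)⁻¹ ≤ (g₀ ^ 4)⁻¹ := by gcongr
  calc ‖star (lift3 z) ⬝ᵥ (J *ᵥ y₀)‖ ^ 2 * ‖star (lift3 z) ⬝ᵥ (J *ᵥ y₁)‖ ^ 2 / (1 - nsq z) ^ 4 * ‖W z‖ ^ 2 *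
        Real.exp (-(Real.pi * (α * (2 * ‖star (lift3 z) ⬝ᵥ (J *ᵥ y₀)‖ ^ 2 / (1 - nsq z)) +
          β * (2 * ‖star (lift3 z) ⬝ᵥ (J *ᵥ y₁)‖ ^ 2 / (1 - nsq z)))))
      ≤ ‖star (lift3 z) ⬝ᵥ (J *ᵥ y₀)‖ ^ 2 * ‖star (lift3 z) ⬝ᵥ (J *ᵥ y₁)‖ ^ 2 / (1 - nsq z) ^ 4 * ‖W z‖ ^ 2 * 1 :=
        mul_le_mul_of_nonneg_left hexp (by positivity)
    _ = ‖star (lift3 z) ⬝ᵥ (J *ᵥ y₀)‖ ^ 2 * ‖star (lift3 z) ⬝ᵥ (J *ᵥ y₁)‖ ^ 2 * ((1 - nsq z) ^ 4)⁻¹ *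
          ‖W z‖ ^ 2 := by rw [div_eq_mul_inv]; ring
    _ ≤ (‖y₀ 0‖ + ‖y₀ 1‖ + ‖y₀ 2‖) ^ 2 * (‖y₁ 0‖ + ‖y₁ 1‖ + ‖y₁ 2‖) ^ 2 * (g₀ ^ 4)⁻¹ * (C₁ + C₂ / g₀) ^ 2 := by
        gcongr

/-- The constant of the far bound at `m = 2s`: `720/(2π σ² r² (2s))⁶ = (720/(4π σ² r²)⁶) · s⁻⁶`. -/
theorem far_const_eq (σ2 r s : ℝ) :
    720 / (2 * Real.pi * (σ2 * r ^ 2) * (2 * s)) ^ 6 = 720 / (4 * Real.pi * σ2 * r ^ 2) ^ 6 * (s ^ 6)⁻¹ := by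
  have h1 : 2 * Real.pi * (σ2 * r ^ 2) * (2 * s) = (4 * Real.pi * σ2 * r ^ 2) * s := by ring
  rw [h1, mul_pow, div_mul_eq_div_div, div_eq_mul_inv]

/-- **INTEGRABILITY ON THE BALL** of the shape integrand, for every `α, β > 0` (bounded and continuous on the ball). -/
theorem integrableOn_shapeInt (y₀ y₁ : Fin 3 → ℂ) (hab : y₀ 0 * y₁ 1 - y₀ 1 * y₁ 0 ≠ 0)
    (hpos : ∀ u v : ℂ, (u ≠ 0 ∨ v ≠ 0) →
      0 < (star (u • y₀ + v • y₁) ⬝ᵥ (J *ᵥ (u • y₀ + v • y₁))).re)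
    (W : (Fin 2 → ℂ) → ℂ) (hWc : ContinuousOn W ball) {C₁ C₂ : ℝ} (hC₁ : 0 ≤ C₁) (hC₂ : 0 ≤ C₂)
    (hWb : ∀ z ∈ ball, ‖W z‖ ≤ C₁ + C₂ / (1 - nsq z)) (hW0 : W (commonZero y₀ y₁) ≠ 0)
    {α β : ℝ} (hα : 0 < α) (hβ : 0 < β) : IntegrableOn (shapeInt y₀ y₁ W α β) ball := by
  obtain ⟨r, hr, hsub, hg, -⟩ := exists_good_radius y₀ y₁ hab hpos W hWc hW0
  have hzs : commonZero y₀ y₁ ∈ ball := commonZero_mem_ball y₀ y₁ hab hpos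
  have hg₀ : 0 < (1 - nsq (commonZero y₀ y₁)) / 2 := by
    have : nsq (commonZero y₀ y₁) < 1 := hzs; linarith
  have hm : 0 < min α β := lt_min hα hβ
  refine ⟨(continuousOn_shapeInt y₀ y₁ W hWc α β).aestronglyMeasurable isOpen_ball.measurableSet, ?_⟩
  refine HasFiniteIntegral.restrict_of_bounded
    (max ((‖y₀ 0‖ + ‖y₀ 1‖ + ‖y₀ 2‖) ^ 2 * (‖y₁ 0‖ + ‖y₁ 1‖ + ‖y₁ 2‖) ^ 2 *
        (((1 - nsq (commonZero y₀ y₁)) / 2) ^ 4)⁻¹ * (C₁ + C₂ / ((1 - nsq (commonZero y₀ y₁)) / 2)) ^ 2)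
      ((‖y₀ 0‖ + ‖y₀ 1‖ + ‖y₀ 2‖) ^ 2 * (‖y₁ 0‖ + ‖y₁ 1‖ + ‖y₁ 2‖) ^ 2 * (C₁ + C₂) ^ 2 *
        (720 / (2 * Real.pi * (‖y₀ 0 * y₁ 1 - y₀ 1 * y₁ 0‖ ^ 2 /
          (4 * (‖y₀ 0‖ ^ 2 + ‖y₀ 1‖ ^ 2 + ‖y₁ 0‖ ^ 2 + ‖y₁ 1‖ ^ 2)) * r ^ 2) * min α β) ^ 6)))
    volume_ball_ne_top.lt_top ?_
  refine ae_restrict_of_forall_mem isOpen_ball.measurableSet fun z hz => ?_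
  rw [Real.norm_eq_abs, abs_of_nonneg (shapeInt_nonneg y₀ y₁ W α β z)]
  by_cases hzr : z ∈ Metric.ball (commonZero y₀ y₁) r
  · exact (shapeInt_le_crude y₀ y₁ W hg₀ hC₂ hα.le hβ.le hz (hg z hzr) (hWb z hz)).trans (le_max_left _ _)
  · have hzr' : r ≤ ‖z - commonZero y₀ y₁‖ := by
      rw [Metric.mem_ball, dist_eq_norm] at hzr
      exact not_lt.1 hzr
    exact (shapeInt_le_far y₀ y₁ hab W hC₁ hr hm (min_le_left _ _) (min_le_right _ _) hz hzr' (hWb z hz)).trans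
      (le_max_right _ _)

/-- **LOWER BOUND:** `c s⁻⁴ ≤ ∫_𝔹 shapeInt (2s) (2s)` for `s ≥ 1`, with `c > 0`. -/
theorem exists_lower_bound (y₀ y₁ : Fin 3 → ℂ) (hab : y₀ 0 * y₁ 1 - y₀ 1 * y₁ 0 ≠ 0)
    (hpos : ∀ u v : ℂ, (u ≠ 0 ∨ v ≠ 0) →
      0 < (star (u • y₀ + v • y₁) ⬝ᵥ (J *ᵥ (u • y₀ + v • y₁))).re)
    (W : (Fin 2 → ℂ) → ℂ) (hWc : ContinuousOn W ball) {C₁ C₂ : ℝ} (hC₁ : 0 ≤ C₁) (hC₂ : 0 ≤ C₂)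
    (hWb : ∀ z ∈ ball, ‖W z‖ ≤ C₁ + C₂ / (1 - nsq z)) (hW0 : W (commonZero y₀ y₁) ≠ 0) :
    ∃ c : ℝ, 0 < c ∧ ∀ s : ℝ, 1 ≤ s →
      c * (s ^ 4)⁻¹ ≤ ∫ z in ball, shapeInt y₀ y₁ W (2 * s) (2 * s) z := by
  obtain ⟨r, hr, hsub, hg, hW⟩ := exists_good_radius y₀ y₁ hab hpos W hWc hW0
  have hzs : commonZero y₀ y₁ ∈ ball := commonZero_mem_ball y₀ y₁ hab hpos
  obtain ⟨g₀, hg₀def⟩ : ∃ g₀ : ℝ, g₀ = (1 - nsq (commonZero y₀ y₁)) / 2 := ⟨_, rfl⟩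
  obtain ⟨w₀, hw₀def⟩ : ∃ w₀ : ℝ, w₀ = ‖W (commonZero y₀ y₁)‖ ^ 2 / 2 := ⟨_, rfl⟩
  rw [← hg₀def] at hg
  rw [← hw₀def] at hW
  have hg₀ : 0 < g₀ := by
    rw [hg₀def]; have : nsq (commonZero y₀ y₁) < 1 := hzs; linarith
  have hw₀ : 0 < w₀ := by
    rw [hw₀def]; have := norm_pos_iff.2 hW0; positivity
  obtain ⟨c₀, hc₀def⟩ : ∃ c₀ : ℝ, c₀ = 4 * Real.pi / g₀ := ⟨_, rfl⟩
  have hc₀ : 0 < c₀ := by rw [hc₀def]; positivity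
  refine ⟨w₀ * ∫ v in Metric.ball (0 : Fin 2 → ℂ) r, modelInt y₀ y₁ c₀ v,
    mul_pos hw₀ (setIntegral_modelInt_pos y₀ y₁ hab hc₀ hr), fun s hs => ?_⟩
  have hspos : 0 < s := by linarith
  have hint : IntegrableOn (shapeInt y₀ y₁ W (2 * s) (2 * s)) ball :=
    integrableOn_shapeInt y₀ y₁ hab hpos W hWc hC₁ hC₂ hWb hW0 (by positivity) (by positivity)
  -- step 1: restrict to the good ball
  have step1 : ∫ z in Metric.ball (commonZero y₀ y₁) r, shapeInt y₀ y₁ W (2 * s) (2 * s) z ≤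
      ∫ z in ball, shapeInt y₀ y₁ W (2 * s) (2 * s) z :=
    setIntegral_mono_set hint (Filter.Eventually.of_forall (shapeInt_nonneg y₀ y₁ W _ _)) hsub.eventuallyLE
  -- step 2: the pointwise lower bound on the good ball
  have hmodel : Integrable (fun z => w₀ * modelInt y₀ y₁ (c₀ * s) (z - commonZero y₀ y₁)) :=
    ((integrable_modelInt y₀ y₁ hab (by positivity)).comp_sub_right (commonZero y₀ y₁)).const_mul w₀
  have step2 : ∫ z in Metric.ball (commonZero y₀ y₁) r, w₀ * modelInt y₀ y₁ (c₀ * s) (z - commonZero y₀ y₁) ≤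
      ∫ z in Metric.ball (commonZero y₀ y₁) r, shapeInt y₀ y₁ W (2 * s) (2 * s) z := by
    refine setIntegral_mono_on hmodel.integrableOn (hint.mono_set hsub) Metric.isOpen_ball.measurableSet
      fun z hz => ?_
    have := shapeInt_ge_near y₀ y₁ hab W hg₀ hspos.le (hg z hz) (hW z hz)
    rwa [hc₀def]
  -- step 3: translate and dilate
  have step3 : ∫ z in Metric.ball (commonZero y₀ y₁) r, w₀ * modelInt y₀ y₁ (c₀ * s) (z - commonZero y₀ y₁) =
      w₀ * ((s ^ 4)⁻¹ * ∫ v in Metric.ball (0 : Fin 2 → ℂ) (Real.sqrt s * r), modelInt y₀ y₁ c₀ v) := by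
    rw [integral_const_mul, setIntegral_ball_translate (fun z => modelInt y₀ y₁ (c₀ * s) (z - commonZero y₀ y₁))]
    simp only [add_sub_cancel_right]
    rw [setIntegral_modelInt_ball y₀ y₁ c₀ hspos r]
  -- step 4: shrink the dilated ball back to `B(0, r)`
  have step4 : ∫ v in Metric.ball (0 : Fin 2 → ℂ) r, modelInt y₀ y₁ c₀ v ≤
      ∫ v in Metric.ball (0 : Fin 2 → ℂ) (Real.sqrt s * r), modelInt y₀ y₁ c₀ v := by
    refine setIntegral_mono_set (integrable_modelInt y₀ y₁ hab hc₀).integrableOn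
      (Filter.Eventually.of_forall (modelInt_nonneg y₀ y₁ c₀)) (Metric.ball_subset_ball ?_).eventuallyLE
    have : 1 ≤ Real.sqrt s := Real.one_le_sqrt.2 hs
    nlinarith
  calc w₀ * (∫ v in Metric.ball (0 : Fin 2 → ℂ) r, modelInt y₀ y₁ c₀ v) * (s ^ 4)⁻¹
      ≤ w₀ * ((s ^ 4)⁻¹ * ∫ v in Metric.ball (0 : Fin 2 → ℂ) (Real.sqrt s * r), modelInt y₀ y₁ c₀ v) := by
        rw [mul_assoc, mul_comm (∫ v in Metric.ball (0 : Fin 2 → ℂ) r, modelInt y₀ y₁ c₀ v)]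
        gcongr
    _ = _ := step3.symm
    _ ≤ _ := step2
    _ ≤ _ := step1

/-- **UPPER BOUND:** `∫_𝔹 shapeInt (2s) (2s) ≤ A₁ s⁻⁴ + A₂ s⁻⁶` for every `s > 0`, with `A₁, A₂ ≥ 0`. -/
theorem exists_upper_bound (y₀ y₁ : Fin 3 → ℂ) (hab : y₀ 0 * y₁ 1 - y₀ 1 * y₁ 0 ≠ 0)
    (hpos : ∀ u v : ℂ, (u ≠ 0 ∨ v ≠ 0) →
      0 < (star (u • y₀ + v • y₁) ⬝ᵥ (J *ᵥ (u • y₀ + v • y₁))).re)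
    (W : (Fin 2 → ℂ) → ℂ) (hWc : ContinuousOn W ball) {C₁ C₂ : ℝ} (hC₁ : 0 ≤ C₁) (hC₂ : 0 ≤ C₂)
    (hWb : ∀ z ∈ ball, ‖W z‖ ≤ C₁ + C₂ / (1 - nsq z)) (hW0 : W (commonZero y₀ y₁) ≠ 0) :
    ∃ A₁ A₂ : ℝ, 0 ≤ A₁ ∧ 0 ≤ A₂ ∧ ∀ s : ℝ, 0 < s →
      ∫ z in ball, shapeInt y₀ y₁ W (2 * s) (2 * s) z ≤ A₁ * (s ^ 4)⁻¹ + A₂ * (s ^ 6)⁻¹ := by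
  obtain ⟨r, hr, hsub, hg, -⟩ := exists_good_radius y₀ y₁ hab hpos W hWc hW0
  have hzs : commonZero y₀ y₁ ∈ ball := commonZero_mem_ball y₀ y₁ hab hpos
  obtain ⟨g₀, hg₀def⟩ : ∃ g₀ : ℝ, g₀ = (1 - nsq (commonZero y₀ y₁)) / 2 := ⟨_, rfl⟩
  rw [← hg₀def] at hg
  have hg₀ : 0 < g₀ := by
    rw [hg₀def]; have : nsq (commonZero y₀ y₁) < 1 := hzs; linarith
  obtain ⟨σ2, hσ2⟩ : ∃ σ2 : ℝ, σ2 = ‖y₀ 0 * y₁ 1 - y₀ 1 * y₁ 0‖ ^ 2 /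
      (4 * (‖y₀ 0‖ ^ 2 + ‖y₀ 1‖ ^ 2 + ‖y₁ 0‖ ^ 2 + ‖y₁ 1‖ ^ 2)) := ⟨_, rfl⟩
  have hσ2pos : 0 < σ2 := by
    rw [hσ2]
    have := entries_sq_pos y₀ y₁ hab
    have := norm_pos_iff.2 hab
    positivity
  have hM : 0 ≤ ∫ v, modelInt y₀ y₁ (4 * Real.pi) v := integral_nonneg (modelInt_nonneg y₀ y₁ _)
  have hvol0 : 0 ≤ (volume : Measure (Fin 2 → ℂ)).real ball := measureReal_nonneg
  refine ⟨(g₀ ^ 4)⁻¹ * (C₁ + C₂ / g₀) ^ 2 * ∫ v, modelInt y₀ y₁ (4 * Real.pi) v,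
    (volume : Measure (Fin 2 → ℂ)).real ball * ((‖y₀ 0‖ + ‖y₀ 1‖ + ‖y₀ 2‖) ^ 2 * (‖y₁ 0‖ + ‖y₁ 1‖ + ‖y₁ 2‖) ^ 2 *
      (C₁ + C₂) ^ 2 * (720 / (4 * Real.pi * σ2 * r ^ 2) ^ 6)), by positivity,
    mul_nonneg hvol0 (by positivity), fun s hs => ?_⟩
  have hint : IntegrableOn (shapeInt y₀ y₁ W (2 * s) (2 * s)) ball :=
    integrableOn_shapeInt y₀ y₁ hab hpos W hWc hC₁ hC₂ hWb hW0 (by positivity) (by positivity)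
  -- split the ball into the good ball and its complement
  have hsplit := integral_inter_add_sdiff (f := shapeInt y₀ y₁ W (2 * s) (2 * s)) (μ := volume)
    (t := Metric.ball (commonZero y₀ y₁) r) Metric.isOpen_ball.measurableSet hint
  rw [Set.inter_eq_right.2 hsub] at hsplit
  rw [← hsplit]
  -- the near part
  have hmodel : Integrable (fun z => (g₀ ^ 4)⁻¹ * (C₁ + C₂ / g₀) ^ 2 *
      modelInt y₀ y₁ (4 * Real.pi * s) (z - commonZero y₀ y₁)) :=
    ((integrable_modelInt y₀ y₁ hab (by positivity)).comp_sub_right (commonZero y₀ y₁)).const_mul _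
  have near1 : ∫ z in Metric.ball (commonZero y₀ y₁) r, shapeInt y₀ y₁ W (2 * s) (2 * s) z ≤
      ∫ z in Metric.ball (commonZero y₀ y₁) r, (g₀ ^ 4)⁻¹ * (C₁ + C₂ / g₀) ^ 2 *
        modelInt y₀ y₁ (4 * Real.pi * s) (z - commonZero y₀ y₁) :=
    setIntegral_mono_on (hint.mono_set hsub) hmodel.integrableOn Metric.isOpen_ball.measurableSet
      fun z hz => shapeInt_le_near y₀ y₁ hab W hg₀ hC₂ hs.le (hg z hz) (hWb z (hsub hz))
  have near2 : ∫ z in Metric.ball (commonZero y₀ y₁) r, (g₀ ^ 4)⁻¹ * (C₁ + C₂ / g₀) ^ 2 *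
      modelInt y₀ y₁ (4 * Real.pi * s) (z - commonZero y₀ y₁) =
      (g₀ ^ 4)⁻¹ * (C₁ + C₂ / g₀) ^ 2 * ∫ w in Metric.ball (0 : Fin 2 → ℂ) r, modelInt y₀ y₁ (4 * Real.pi * s) w := by
    rw [integral_const_mul,
      setIntegral_ball_translate (fun z => modelInt y₀ y₁ (4 * Real.pi * s) (z - commonZero y₀ y₁))]
    simp only [add_sub_cancel_right]
  have near3 : ∫ w in Metric.ball (0 : Fin 2 → ℂ) r, modelInt y₀ y₁ (4 * Real.pi * s) w ≤
      ∫ w, modelInt y₀ y₁ (4 * Real.pi * s) w :=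
    setIntegral_le_integral (integrable_modelInt y₀ y₁ hab (by positivity))
      (Filter.Eventually.of_forall (modelInt_nonneg y₀ y₁ _))
  have near4 : ∫ w, modelInt y₀ y₁ (4 * Real.pi * s) w = (s ^ 4)⁻¹ * ∫ v, modelInt y₀ y₁ (4 * Real.pi) v :=
    integral_modelInt y₀ y₁ (4 * Real.pi) hs
  have near : ∫ z in Metric.ball (commonZero y₀ y₁) r, shapeInt y₀ y₁ W (2 * s) (2 * s) z ≤
      (g₀ ^ 4)⁻¹ * (C₁ + C₂ / g₀) ^ 2 * (∫ v, modelInt y₀ y₁ (4 * Real.pi) v) * (s ^ 4)⁻¹ := by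
    calc ∫ z in Metric.ball (commonZero y₀ y₁) r, shapeInt y₀ y₁ W (2 * s) (2 * s) z
        ≤ _ := near1
      _ = _ := near2
      _ ≤ (g₀ ^ 4)⁻¹ * (C₁ + C₂ / g₀) ^ 2 * ∫ w, modelInt y₀ y₁ (4 * Real.pi * s) w := by gcongr
      _ = _ := by rw [near4]; ring
  -- the far part
  have hfin : volume (ball \ Metric.ball (commonZero y₀ y₁) r) ≠ ⊤ :=
    ((measure_mono Set.sdiff_subset).trans_lt volume_ball_ne_top.lt_top).ne
  have far1 : ∫ z in ball \ Metric.ball (commonZero y₀ y₁) r, shapeInt y₀ y₁ W (2 * s) (2 * s) z ≤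
      ∫ _z in ball \ Metric.ball (commonZero y₀ y₁) r,
        (‖y₀ 0‖ + ‖y₀ 1‖ + ‖y₀ 2‖) ^ 2 * (‖y₁ 0‖ + ‖y₁ 1‖ + ‖y₁ 2‖) ^ 2 * (C₁ + C₂) ^ 2 *
          (720 / (4 * Real.pi * σ2 * r ^ 2) ^ 6 * (s ^ 6)⁻¹) := by
    refine setIntegral_mono_on (hint.mono_set Set.sdiff_subset) (integrableOn_const hfin)
      (isOpen_ball.measurableSet.diff Metric.isOpen_ball.measurableSet) fun z hz => ?_
    have hzr : r ≤ ‖z - commonZero y₀ y₁‖ := by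
      have := hz.2
      rw [Metric.mem_ball, dist_eq_norm] at this
      exact not_lt.1 this
    have := shapeInt_le_far y₀ y₁ hab W hC₁ hr (by positivity : 0 < 2 * s) le_rfl le_rfl hz.1 hzr (hWb z hz.1)
    rw [← hσ2, far_const_eq σ2 r s] at this
    exact this
  rw [setIntegral_const] at far1
  have far : ∫ z in ball \ Metric.ball (commonZero y₀ y₁) r, shapeInt y₀ y₁ W (2 * s) (2 * s) z ≤
      (volume : Measure (Fin 2 → ℂ)).real ball * ((‖y₀ 0‖ + ‖y₀ 1‖ + ‖y₀ 2‖) ^ 2 *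
        (‖y₁ 0‖ + ‖y₁ 1‖ + ‖y₁ 2‖) ^ 2 * (C₁ + C₂) ^ 2 * (720 / (4 * Real.pi * σ2 * r ^ 2) ^ 6)) * (s ^ 6)⁻¹ := by
    refine far1.trans ?_
    rw [smul_eq_mul]
    have hvol : (volume : Measure (Fin 2 → ℂ)).real (ball \ Metric.ball (commonZero y₀ y₁) r) ≤
        (volume : Measure (Fin 2 → ℂ)).real ball :=
      measureReal_mono Set.sdiff_subset volume_ball_ne_top
    have : 0 ≤ (‖y₀ 0‖ + ‖y₀ 1‖ + ‖y₀ 2‖) ^ 2 * (‖y₁ 0‖ + ‖y₁ 1‖ + ‖y₁ 2‖) ^ 2 * (C₁ + C₂) ^ 2 *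
        (720 / (4 * Real.pi * σ2 * r ^ 2) ^ 6 * (s ^ 6)⁻¹) := by positivity
    calc _ ≤ (volume : Measure (Fin 2 → ℂ)).real ball * ((‖y₀ 0‖ + ‖y₀ 1‖ + ‖y₀ 2‖) ^ 2 *
          (‖y₁ 0‖ + ‖y₁ 1‖ + ‖y₁ 2‖) ^ 2 * (C₁ + C₂) ^ 2 *
          (720 / (4 * Real.pi * σ2 * r ^ 2) ^ 6 * (s ^ 6)⁻¹)) := mul_le_mul_of_nonneg_right hvol this
      _ = _ := by ring
  linarith



end Summit.Ventures.HodgeRepro.Tier4.Line3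

end
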